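import Literature.MathematicalPhysics.QuantumFieldTheory.Balaban1983to89.B9LettersHAtOneG0
import Literature.MathematicalPhysics.QuantumFieldTheory.Balaban1983to89.B9Thm313Whole

/-!
# `Balaban1983to89.B9Letters313AtOneQ` — [B9] Thm 3.13's reduction letters AT THE TRIVIAL BACKGROUND, second batch: the averaging-operator
# letters `Letters313.q2 ∕ q1` (`Q(1)` local and bounded between the state classes `𝔠⁽ᵖ⁾ → 𝔠_Z⁽ᵖ⁾`) and the SPLIT `G₀Q*` letter
# `Letters313.gQs1` (`G₀(1)Q*(1) : 𝔠_Z^{len} → 𝔠⁽¹⁾`) HOLD AT `U = 1` at node00-def-Y's pinned letters, uniformly on the k-level census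

T. Bałaban, *Propagators for lattice gauge theories in a background field*, Commun. Math. Phys. **99** (1985) 389–434
[`Balaban1985BackgroundPropagators`, "B9"]; [4] = T. Bałaban, *Propagators and renormalization transformations for lattice gauge
theories. II*, Commun. Math. Phys. **96** (1984) 223–250 [`Balaban1984PropagatorsII`].

statement-level skeleton of published theorems with citation tags; proofs where landed; nothing here is a claim about the Yang–Mills
mass gap

THE PRINTED LOCI (verbatim).  [B9] p. 426 (Thm 3.13): *"The formulas (3.147), (3.153) permit us to reduce properties of the operators 𝔓, 𝔊 to
the corresponding properties of the operators G′, (Q′G′²Q′\*)⁻¹, G₁, (QG₁Q\*)⁻¹"*; p. 398 (remark after (3.47)): the powers of `Lʲη` may be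
split between the two blocks; p. 407, before Cor. 3.5: *"There we have proved these theorems for operators with the external gauge field
configuration U = 1."*  [4] (2.18)–(2.20) p. 226 (the averaging operator `Q`), Prop. 2.6 (2.136) p. 247, Lemma 2.1 (2.60)–(2.61) p. 234.

THE POINT.  dag-n06-d's N06 certificate of record (edition 19, `Summits/…/BalabanUVNodesN06AtOpsYNuOfRecordV6EPairMZ`) displays the binder
`hletters13 : … → B9Thm313Whole.Letters313 (𝔬12 x) 1 (H x) … B12₃ δ12₃ U` (dag-n06-l's schema, nine fields); dag-n06-h's `B9LettersHAtOneG0` inhabits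
`gQs2` at `U ↦ 1`.  THIS FILE inhabits three more fields at `U ↦ 1`, none touching the C-letters (dag-n06-h's LOCATED «C-LETTER-FLAT-AT-ONE»):
`q2 ∕ q1` — `Q(U₁)` pinned (`hQco12`) to node00-def-Y's `QcoKH … parBY U₁` is, at `cfg U₁ = 1`, the lift of the FLAT kernel `qK` (`Node00.QY_one`), weights
`≥ 0` of total mass one (dag-n06-i `sum_qwt_eq_one`) vanishing unless the carrier blocks are within `ℓ + 3` (dag-n06-h `dist_blkV1_le_of_qwt_ne_zero`) —
a local contraction, read through dag-n06-d's coordinate functor slice by slice (`B9Prop26AtPinsOne.hasMajorantHom_coordOpKH_of_liftY`) and moved between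
the classes `𝔠⁽ᵖ⁾ → 𝔠_Z⁽ᵖ⁾` by the (2.60) scale transfer `B9GeoLemma21KLevelV1.transferL_geo9K` under an M-threshold (§1–§2); `gQs1` — the split form
`|(G₀Q*b)(x)| ≦ B₃·Lʲη·L^{j′}η·e^{−δd}|b|`: dag-n06-h's chain (`hasMajorantHom_comp_qsK_bI` on N03's (2.136)₀ majorant, `O_QsY_one_liftY`,
`GcoK_comp_QscoKH_one`) gives the two-space majorant `K·(Lʲη)(a)²·e^{−¾δd}` and ONE power of `Lʲη` is transferred to the source block by (2.60) (§3);
§4 packages the three bodies UNIFORMLY on the census (one threshold, one rate, one constant up to the reading factor `(cR39 b)⁻¹` of `Q`).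

HONEST SCOPE.  A READING file: the analytic inputs are N03's Prop. 2.6 (via dag-n06-h's `hasMajorant_Gop_kIdx`), p21's Lemma 2.1
(`consts_260_261`) and the (2.60) transfer `transferL_geo9K`, all tree theorems cited by name; pins ∕ carriers ∕ functor are dag-n06-d's, letters
node00-def-Y's, schema dag-n06-l's; nothing of [B9] at curved `U` is asserted and the displayed `∀U`-binder `hletters13` is NOT witnessed (its
`c1_2 ∕ c1_1` fields at the flat `C1coK` pin share dag-n06-h's located obstruction).  COUNT-NEUTRAL; N06 is NOT discharged; one finite lattice
at a time; nothing continuum, nothing about the mass gap.  Cell `pub-ymgap` (HUMAN RULING D-0062 ∕ D-0149), Track A node N06 [B9], width seat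
`pub-ymgap-dag-n06-w3` (g0), 2026-08-27.
-/

noncomputable section

namespace Literature.MathematicalPhysics.QuantumFieldTheory.Balaban1983to89.B9Letters313AtOneQ

open B6MultiLevelTorusOperator (TDomains)
open B6Geom246MultiLevelTorus (geomT)
open B6GlobalChartV1 (PV blkV1)
open B6KLevelCensusIndexV1 (KIdx kGeo kGeoG)
open B6Prop26Census2136KLevelV1 (Gop)
open B6RandomWalk (HasMajorant BlockSupp)
open B6RandomWalkHom (HasMajorantHom)
open B6Ineq2142KLevelV1 (lvl β qwt qwt_nonneg)
open B6Ineq288MultiLevelTorus (dist_symm_geoBT)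
open B9Eq3132Ineq2142Covariant (qK_apply sum_qwt_eq_one)
open B9Thm314GpFlatMultiLevelTorus (consts_260_261)
open B6Lemma21Repaired (Ineq261With)
open B9GeoNormsKLevelV1 (geo9K)
open B9GeoLemma21KLevelV1 (one_le_Mh geo9K_len_pos geo9K_dist_comm geo9K_one_le_L geo9K_M_nonneg transferL_geo9K)
open B9Ineq349SiteComposite (distB distB_nonneg)
open B9Ineq349SiteFromBlocks (distB_triangle)
open B9Thm39ReadingCoords (cR39 cR39_nonneg)
open B9Thm34Ext (toB6)
open B9SectDSup (weightNorm)
open B11SectG (HasMaj BlockNorm)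
open B9Thm312Whole (cNorm GeoOK Ops wt wt_nonneg)
open B9CoReadingCoords B9CoReadingCoordsH B9Prop26AtPinsOne B9LettersHAtOneG0
open Node00 Node00.OpsYSectDCoords
open scoped Matrix

variable {d ℓ : ℕ} {hd : 1 ≤ d + 1} {hL : Odd (ℓ + 1) ∧ 1 < ℓ + 1} {b₀ b₁ : ℝ}

/-! ## §1 The flat averaging kernel `Q♭` after the certificate's block map `bI`: bounded by the sup of its argument, vanishing beyond `ℓ + 4` -/

section Flat

variable (i : KIdx d ℓ hd hL b₀ b₁) {bI : FBondY i → IBondY i}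

/-- `(Q♭ω)(y) = Σ_f q_y(f)·ω(f)` (`qK y f = q_y(f)`, r03's weight). [cite: Balaban1984PropagatorsII, (2.18)–(2.20) p.226; Balaban1984PropagatorsI, (1.18) p.20] -/
theorem qK_mulVec_apply (ω : FBondY i → ℝ) (y : IBondY i) : (qK i *ᵥ ω) y = ∑ f, qwt i.hN i.D i.hk y f * ω f := by
  simp only [Matrix.mulVec, dotProduct, qK_apply]

/-- **`Q♭` IS A CONTRACTION IN THE SUP NORM**: `|ω| ≤ B` pointwise ⇒ `|(Q♭ω)(y)| ≤ B` (weights `≥ 0` of total mass one).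
[cite: Balaban1984PropagatorsI, (1.18) p.20, (1.15) p.19; Balaban1984PropagatorsII, (2.20) p.226] -/
theorem abs_qK_mulVec_le {ω : FBondY i → ℝ} {B : ℝ} (hB : ∀ f, |ω f| ≤ B) (y : IBondY i) : |(qK i *ᵥ ω) y| ≤ B := by
  rw [qK_mulVec_apply]
  calc |∑ f, qwt i.hN i.D i.hk y f * ω f| ≤ ∑ f, |qwt i.hN i.D i.hk y f * ω f| := Finset.abs_sum_le_sum_abs _ _
    _ = ∑ f, qwt i.hN i.D i.hk y f * |ω f| := Finset.sum_congr rfl fun f _ => by rw [abs_mul, abs_of_nonneg (qwt_nonneg _ _ _ _ _)]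
    _ ≤ ∑ f, qwt i.hN i.D i.hk y f * B := Finset.sum_le_sum fun f _ => mul_le_mul_of_nonneg_left (hB f) (qwt_nonneg _ _ _ _ _)
    _ = B := by rw [← Finset.sum_mul, sum_qwt_eq_one i y, one_mul]

/-- a weight `q_y(f) ≠ 0` at a fine bond re-blocked by a 1-faithful `bI` puts `y` within `ℓ + 4` of `bI f` in the geometry `geo9K` of index bonds.
[cite: Balaban1984PropagatorsII, (2.45)–(2.46) p.231, (2.54) p.233; Balaban1985BackgroundPropagators, p.398 (remark after (3.47))] -/
theorem dist_le_of_qwt_ne_zero_bI (hβ1 : ∀ f : FBondY i, (geomT i.D).dist (β i.hN i.D i.hk (bI f)) (blkV1 i.hN i.D f) ≤ 1)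
    {y : IBondY i} {f : FBondY i} (hf : qwt i.hN i.D i.hk y f ≠ 0) : (geo9K i).dist y (bI f) ≤ (ℓ : ℝ) + 4 := by
  change distB i (β i.hN i.D i.hk y) (β i.hN i.D i.hk (bI f)) ≤ (ℓ : ℝ) + 4
  have h3 : distB i (β i.hN i.D i.hk y) (blkV1 i.hN i.D f) ≤ (ℓ : ℝ) + 3 := dist_blkV1_le_of_qwt_ne_zero i hf
  have h1 : distB i (β i.hN i.D i.hk (bI f)) (blkV1 i.hN i.D f) ≤ 1 := hβ1 f
  have hs : distB i (blkV1 i.hN i.D f) (β i.hN i.D i.hk (bI f)) = distB i (β i.hN i.D i.hk (bI f)) (blkV1 i.hN i.D f) :=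
    dist_symm_geoBT (toKT i) _ _
  linarith [distB_triangle i (β i.hN i.D i.hk y) (blkV1 i.hN i.D f) (β i.hN i.D i.hk (bI f))]

/-- ★ **THE FLAT `Q` KERNEL AS A MAJORISED TWO-SPACE OPERATOR** from fine-bond functions (block map `bI`, 1-faithful) to index-bond functions
(block map the identity), in `geo9K`: majorant `e^{δ(ℓ+4)}·e^{−δd(y,a′)}` for every `δ ≥ 0` — `Q♭` contracts the sup norm and sees only the
blocks within `ℓ + 4`. [cite: Balaban1984PropagatorsII, (2.18)–(2.20) p.226, (2.45)–(2.46) p.231, (2.51) p.232; Balaban1985BackgroundPropagators, Thm 3.13 p.426 (the letter Q)] -/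
theorem hasMajorantHom_qK_bI (hβ1 : ∀ f : FBondY i, (geomT i.D).dist (β i.hN i.D i.hk (bI f)) (blkV1 i.hN i.D f) ≤ 1)
    {δ : ℝ} (hδ : 0 ≤ δ) (R₀ : ℝ) (H₀ : Prop) [Fintype (geo9K i).Site] :
    HasMajorantHom (g := toB6 (geo9K i) R₀ H₀) bI (fun a : IBondY i => a) (Matrix.toLin' (qK i))
      (fun a a' => Real.exp (δ * ((ℓ : ℝ) + 4)) * Real.exp (-(δ * (geo9K i).dist a a'))) := by
  intro a' ω B hω y
  change IBondY i at y
  change IBondY i at a'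
  rw [Matrix.toLin'_apply]
  have hK0 : 0 ≤ Real.exp (δ * ((ℓ : ℝ) + 4)) * Real.exp (-(δ * (geo9K i).dist y a')) := by positivity
  by_cases hnear : (geo9K i).dist y a' ≤ (ℓ : ℝ) + 4
  · have hωB : ∀ f, |ω f| ≤ B := fun f => by
      by_cases hf : bI f = a'
      · exact hω.bound f hf
      · rw [hω.off f hf, abs_zero]; exact hω.nonneg
    have hK1 : 1 ≤ Real.exp (δ * ((ℓ : ℝ) + 4)) * Real.exp (-(δ * (geo9K i).dist y a')) := by
      rw [← Real.exp_add]
      exact Real.one_le_exp (by nlinarith [mul_le_mul_of_nonneg_left hnear hδ])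
    calc |(qK i *ᵥ ω) y| ≤ B := abs_qK_mulVec_le i hωB y
      _ = 1 * B := (one_mul B).symm
      _ ≤ _ := mul_le_mul_of_nonneg_right hK1 hω.nonneg
  · have h0 : (qK i *ᵥ ω) y = 0 := by
      rw [qK_mulVec_apply]
      refine Finset.sum_eq_zero fun f _ => ?_
      by_cases hf : bI f = a'
      · by_cases hq : qwt i.hN i.D i.hk y f = 0
        · rw [hq, zero_mul]
        · exact absurd (hf ▸ dist_le_of_qwt_ne_zero_bI i hβ1 hq) hnear
      · rw [hω.off f hf, mul_zero]
    rw [h0, abs_zero]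
    exact mul_nonneg hK0 hω.nonneg

/-- a non-negative multiple of a two-space operator with a block majorant. [cite: Balaban1984PropagatorsII, (2.51) p.232, bookkeeping] -/
theorem hasMajorantHom_smul_of_nonneg {G : B6.Geometry} {X V : Type} {blkX : X → G.Site} {blkV : V → G.Site}
    {T : (X → ℝ) →ₗ[ℝ] (V → ℝ)} {K : G.Site → G.Site → ℝ} (h : HasMajorantHom blkX blkV T K) {r : ℝ} (hr : 0 ≤ r) :
    HasMajorantHom blkX blkV (r • T) (fun a a' => r * K a a') := by
  intro y' μ B hμ v
  rw [LinearMap.smul_apply, Pi.smul_apply, smul_eq_mul, abs_mul, abs_of_nonneg hr, mul_assoc]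
  exact mul_le_mul_of_nonneg_left (h y' μ B hμ v) hr

end Flat

/-! ## §2 AT THE PINS: `Q(U₁)` at a configuration reading `1` is the mixed model of the flat kernel; the letters `q2 ∕ q1` in the state classes -/

section QLetters

variable {𝔸 : Type} [NormedRing 𝔸] [NormedAlgebra ℂ 𝔸] [CompleteSpace 𝔸] [FiniteDimensional ℝ 𝔸]
variable {κ : Type} [Fintype κ]
variable (i : KIdx d ℓ hd hL b₀ b₁) (b : Module.Basis κ ℝ 𝔸) (B : B9.Backgrounds) (cfg : B.Cfg → CfgY 𝔸 i) (parB : BondParY 𝔸 i)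

/-- ★ **`Q(U₁)` AT THE PINS, AT `U = 1`, IS THE MIXED MODEL OF THE FLAT KERNEL**: `QcoKH … parB U₁ = (cR39 b)⁻¹ • coordOpKH b (fun _ => Q♭ lifted)`
(transporters trivial at `1`, node00-def-Y `QY_one`). [cite: Balaban1985BackgroundPropagators, (3.14)–(3.15) p.393, (3.110) p.417, Cor. 3.5 p.407, dictionary] -/
theorem QcoKH_one (hparB : ∀ s s', parB (fun _ _ => 1) s s' = 1) {U₁ : B.Cfg} (hU₁ : cfg U₁ = fun _ _ => 1) :
    QcoKH i b B cfg parB U₁ = (cR39 b)⁻¹ • coordOpKH b (fun _ : Fin (d + 1) => (liftMatY 𝔸 (qK i)).restrictScalars ℝ) := by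
  rw [QcoKH, hU₁, QY_one i hparB]

omit [CompleteSpace 𝔸] [FiniteDimensional ℝ 𝔸] [Fintype κ] in
/-- the lifted flat kernel acts on product-form inputs as `Q♭`: `Q♭̃(J ⊗ E) = (Q♭J) ⊗ E`. [cite: Balaban1985BackgroundPropagators, (3.14)–(3.15) p.393, dictionary] -/
theorem liftMatY_qK_liftY (J : FBondY i → ℝ) (E : 𝔸) :
    ((liftMatY 𝔸 (qK i)).restrictScalars ℝ) (liftY J E) = liftY (Matrix.toLin' (qK i) J) E := by
  rw [LinearMap.restrictScalars_apply, liftMatY_liftY, Matrix.toLin'_apply]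

/-- ★ **THE PINNED `Q(U₁)` AT `U = 1` IS MAJORISED** between the certificate's carriers `XBK` (block map `blkBK bI`) and `XHK` (block map `blkHK`):
majorant `(cR39 b)⁻¹·e^{δ(ℓ+4)}·e^{−δd}`, every `δ ≥ 0`. [cite: Balaban1985BackgroundPropagators, (3.14)–(3.15) p.393, (3.42) p.397, Thm 3.13 p.426; Balaban1984PropagatorsII, (2.51) p.232] -/
theorem hasMajorantHom_QcoKH_one (hparB : ∀ s s', parB (fun _ _ => 1) s s' = 1) {U₁ : B.Cfg} (hU₁ : cfg U₁ = fun _ _ => 1)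
    {bI : FBondY i → IBondY i} (hβ1 : ∀ f : FBondY i, (geomT i.D).dist (β i.hN i.D i.hk (bI f)) (blkV1 i.hN i.D f) ≤ 1)
    {δ : ℝ} (hδ : 0 ≤ δ) (R₀ : ℝ) (H₀ : Prop) [Fintype (geo9K i).Site] :
    HasMajorantHom (g := toB6 (geo9K i) R₀ H₀) (blkBK i bI) (blkHK i) (QcoKH i b B cfg parB U₁)
      (fun a a' => (cR39 b)⁻¹ * (Real.exp (δ * ((ℓ : ℝ) + 4)) * Real.exp (-(δ * (geo9K i).dist a a')))) := by
  rw [QcoKH_one i b B cfg parB hparB hU₁]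
  exact hasMajorantHom_smul_of_nonneg
    (hasMajorantHom_coordOpKH_of_liftY b (G := toB6 (geo9K i) R₀ H₀) (blk' := bI) (blk := fun a : IBondY i => a)
      (T := fun _ : Fin (d + 1) => Matrix.toLin' (qK i)) (fun _ J E => liftMatY_qK_liftY i J E)
      fun _ => hasMajorantHom_qK_bI i hβ1 hδ R₀ H₀)
    (inv_nonneg.mpr (cR39_nonneg b))

/-- **the (2.60) scale transfer for a natural power**: `(L^{j′}η)ᵖ ≤ Lᵖ·e^{εd(y,y′)}·(Lʲη)ᵖ` on `geo9K`, for members above the threshold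
`p·log L ≤ ε·(2L² − 1)·M`. [cite: Balaban1984PropagatorsII, Lemma 2.1 (2.60) p.234 with (2.88) p.238] -/
theorem len_pow_le_of_transfer {ε : ℝ} (hε : 0 < ε) (p : ℕ)
    (hM : (p : ℝ) * Real.log (geo9K i).L ≤ ε * (2 * ((ℓ : ℝ) + 1) ^ 2 - 1) * (geo9K i).M) (y y' : (geo9K i).Site) :
    (geo9K i).len y' ^ p ≤ (geo9K i).L ^ p * Real.exp (ε * (geo9K i).dist y y') * (geo9K i).len y ^ p := by
  have hq : |(p : ℝ)| * Real.log (geo9K i).L ≤ ε * (2 * ((ℓ : ℝ) + 1) ^ 2 - 1) * (geo9K i).M := by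
    rwa [abs_of_nonneg (Nat.cast_nonneg p)]
  have h := transferL_geo9K i hε (p : ℝ) hq y y'
  rwa [abs_of_nonneg (Nat.cast_nonneg p), Real.rpow_natCast, Real.rpow_natCast, Real.rpow_natCast] at h

/-- the threshold of `len_pow_le_of_transfer` from a plain M-threshold `p·log L ∕ ε ≤ M` (`2L² − 1 ≥ 1`). [cite: Balaban1984PropagatorsII, (2.60) p.234, bookkeeping] -/
theorem transfer_threshold {ε : ℝ} (hε : 0 < ε) (p : ℕ) (hM : (p : ℝ) * Real.log (((ℓ + 1 : ℕ) : ℝ)) / ε ≤ (geo9K i).M) :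
    (p : ℝ) * Real.log (geo9K i).L ≤ ε * (2 * ((ℓ : ℝ) + 1) ^ 2 - 1) * (geo9K i).M := by
  have hR1 : (1 : ℝ) ≤ 2 * ((ℓ : ℝ) + 1) ^ 2 - 1 := by nlinarith [(Nat.cast_nonneg ℓ : (0 : ℝ) ≤ ℓ)]
  calc (p : ℝ) * Real.log (geo9K i).L = (p : ℝ) * Real.log (((ℓ + 1 : ℕ) : ℝ)) := rfl
    _ ≤ (geo9K i).M * ε := (div_le_iff₀ hε).mp hM
    _ = ε * 1 * (geo9K i).M := by ring
    _ ≤ ε * (2 * ((ℓ : ℝ) + 1) ^ 2 - 1) * (geo9K i).M :=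
        mul_le_mul_of_nonneg_right (mul_le_mul_of_nonneg_left hR1 hε.le) (geo9K_M_nonneg i)

variable {Y W : Type}

/-- ★★ **THE LETTERS `q2 ∕ q1` OF `Letters313` AT `U = 1`** — `Q(U₁) : 𝔠⁽ᵖ⁾ → 𝔠_Z⁽ᵖ⁾` with the majorant `(cR39 b)⁻¹·Lᵖ·e^{2ε(ℓ+4)}·e^{−εd}`, at ANY
letter record `𝔬` over `geo9K i` with carriers `XBK ∕ · ∕ XHK ∕ ·` whose `Q` at a configuration `U₁` reading `1` is pinned to node00-def-Y's model
`QcoKH … parB` (the certificate's `hQco12`; block maps `hblk12 ∕ hblkZ12`, `bI` 1-faithful), for every member above the (2.60) threshold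
`p·log L ≤ ε(2L² − 1)M`: `Q♭` local and bounded (§1) + the scale transfer of the class weight `(L^{j′}η)^{−p} ↦ (Lʲη)^{−p}`.
[cite: Balaban1985BackgroundPropagators, Thm 3.13 p.426 (the letter Q, classes p → Zᵖ), (3.110) p.417, (3.42) p.397, Cor. 3.5 p.407; Balaban1984PropagatorsII, (2.18)–(2.20) p.226, (2.51) p.232, (2.60) p.234] -/
theorem hasMaj_Q_one (hG : GeoOK (geo9K i)) [Fintype (geo9K i).Site] [Fintype Y] [Fintype W]
    (hparB : ∀ s s', parB (fun _ _ => 1) s s' = 1) {U₁ : B.Cfg} (hU₁ : cfg U₁ = fun _ _ => 1)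
    {bI : FBondY i → IBondY i} (hβ1 : ∀ f : FBondY i, (geomT i.D).dist (β i.hN i.D i.hk (bI f)) (blkV1 i.hN i.D f) ≤ 1)
    (𝔬 : Ops (geo9K i) B (XBK κ i) Y (XHK κ i) W) (hblk : 𝔬.blk = blkBK i bI) (hblkZ : 𝔬.blkZ = blkHK i)
    (hQ : 𝔬.Q U₁ = QcoKH i b B cfg parB U₁) {ε : ℝ} (hε : 0 < ε) (p : ℕ)
    (hM : (p : ℝ) * Real.log (geo9K i).L ≤ ε * (2 * ((ℓ : ℝ) + 1) ^ 2 - 1) * (geo9K i).M) {R₀ : ℝ} {H₀ : Prop} :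
    HasMaj (cNorm R₀ H₀ 𝔬.blk hG.lenle p) (cNorm R₀ H₀ 𝔬.blkZ hG.lenle p) (𝔬.Q U₁)
      (fun a a' => (cR39 b)⁻¹ * (geo9K i).L ^ p * Real.exp (2 * ε * ((ℓ : ℝ) + 4)) * Real.exp (-(ε * (geo9K i).dist a a'))) := by
  rw [hblk, hblkZ, hQ]
  have h2ε : (0 : ℝ) ≤ 2 * ε := by positivity
  have hK := hasMajorantHom_QcoKH_one i b B cfg parB hparB hU₁ hβ1 h2ε R₀ H₀
  have hK0 : ∀ a a', 0 ≤ (cR39 b)⁻¹ * (Real.exp (2 * ε * ((ℓ : ℝ) + 4)) * Real.exp (-(2 * ε * (geo9K i).dist a a'))) := fun a a' =>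
    mul_nonneg (inv_nonneg.mpr (cR39_nonneg b)) (by positivity)
  have h0 := B9Thm37AllNorms.hasMaj_of_hasMajorantHom (G := toB6 (geo9K i) R₀ H₀) (blkBK i bI) (blkHK i) hK0 hK
  refine (B9Thm312WholeLeaf.hasMaj_cNorm_of_hasMaj hG p p h0).mono fun y y' => ?_
  have ht := len_pow_le_of_transfer i hε p hM y y'
  have hly : 0 < (geo9K i).len y ^ p := pow_pos (hG.lenpos y) p
  have hw : wt (geo9K i) p y * (geo9K i).len y' ^ p ≤ (geo9K i).L ^ p * Real.exp (ε * (geo9K i).dist y y') := by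
    rw [wt, inv_mul_le_iff₀ hly]
    calc (geo9K i).len y' ^ p ≤ (geo9K i).L ^ p * Real.exp (ε * (geo9K i).dist y y') * (geo9K i).len y ^ p := ht
      _ = (geo9K i).len y ^ p * ((geo9K i).L ^ p * Real.exp (ε * (geo9K i).dist y y')) := by ring
  have hexp : Real.exp (-(2 * ε * (geo9K i).dist y y')) * Real.exp (ε * (geo9K i).dist y y') = Real.exp (-(ε * (geo9K i).dist y y')) := by
    rw [← Real.exp_add]; congr 1; ring
  calc (cR39 b)⁻¹ * (Real.exp (2 * ε * ((ℓ : ℝ) + 4)) * Real.exp (-(2 * ε * (geo9K i).dist y y'))) * wt (geo9K i) p y *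
        (geo9K i).len y' ^ p
      = (cR39 b)⁻¹ * (Real.exp (2 * ε * ((ℓ : ℝ) + 4)) * Real.exp (-(2 * ε * (geo9K i).dist y y'))) *
          (wt (geo9K i) p y * (geo9K i).len y' ^ p) := by ring
    _ ≤ (cR39 b)⁻¹ * (Real.exp (2 * ε * ((ℓ : ℝ) + 4)) * Real.exp (-(2 * ε * (geo9K i).dist y y'))) *
          ((geo9K i).L ^ p * Real.exp (ε * (geo9K i).dist y y')) := mul_le_mul_of_nonneg_left hw (hK0 y y')
    _ = (cR39 b)⁻¹ * (geo9K i).L ^ p * Real.exp (2 * ε * ((ℓ : ℝ) + 4)) *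
          (Real.exp (-(2 * ε * (geo9K i).dist y y')) * Real.exp (ε * (geo9K i).dist y y')) := by ring
    _ = _ := by rw [hexp]

end QLetters

/-! ## §3 AT THE PINS: the split `G₀Q*` letter `gQs1` of `Letters313` at a configuration reading `1` -/

section Split

variable {𝔸 : Type} [NormedRing 𝔸] [NormedAlgebra ℂ 𝔸] [CompleteSpace 𝔸] [FiniteDimensional ℝ 𝔸]
variable {κ : Type} [Fintype κ]
variable (i : KIdx d ℓ hd hL b₀ b₁) (b : Module.Basis κ ℝ 𝔸) (B : B9.Backgrounds) (cfg : B.Cfg → CfgY 𝔸 i)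
  (O : BondOpY 𝔸 i) (parB : BondParY 𝔸 i)
variable {Y W : Type}

/-- ★★ **THE SPLIT LETTER `gQs1` OF `Letters313` AT `U = 1`** — `G₀(1)Q*(1) : 𝔠_Z^{len} → 𝔠⁽¹⁾`, i.e. `|(G₀Q*b)(x)| ≦ B₃·Lʲη·L^{j′}η·e^{−δ′d}|b|`
(p. 398: the two powers of `Lʲη` split between the blocks), at a letter record pinned as in dag-n06-h's `hasMaj_G0_Qstar_one` (`hG0co12 ∕ hQsco12`,
`hblk12 ∕ hblkZ12`, `O(1)(J ⊗ E) = (GJ) ⊗ E`, transporters trivial at `1`, `bI` level- and 1-faithful), from the (2.136)₀ torus majorant of `G = Δ_a⁻¹`,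
(2.61), and the (2.60) transfer of ONE power (threshold `log L ≤ ε(2L² − 1)M`).  Constants: `B₃ = C·c·e^{¾δ(ℓ+4)}·L`, `δ′ = ¾δ − ε`.
[cite: Balaban1985BackgroundPropagators, Thm 3.13 p.426 (letter G₀Q*, classes Z^{len} → 1), p.398 (remark after (3.47)), (3.126) p.420, Cor. 3.5 p.407; Balaban1984PropagatorsII, Prop. 2.6 (2.136) p.247, Lemma 2.1 (2.60)–(2.61) p.234] -/
theorem hasMaj_G0_Qstar_one_split (hG : GeoOK (geo9K i)) [Fintype (geo9K i).Site] [Fintype Y] [Fintype W]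
    (hc : cR39 b ≠ 0) (hparB : ∀ s s', parB (fun _ _ => 1) s s' = 1)
    (hO : ∀ (J : FBondY i → ℝ) (E : 𝔸), O (fun _ _ => 1) (liftY J E) = liftY (Gop i J) E) {U₁ : B.Cfg} (hU₁ : cfg U₁ = fun _ _ => 1)
    {bI : FBondY i → IBondY i} (hlev : ∀ f : FBondY i, lvl i.hN i.D i.hk (bI f) = (blkV1 i.hN i.D f).1.1)
    (hβ1 : ∀ f : FBondY i, (geomT i.D).dist (β i.hN i.D i.hk (bI f)) (blkV1 i.hN i.D f) ≤ 1)
    (𝔬 : Ops (geo9K i) B (XBK κ i) Y (XHK κ i) W) (hblk : 𝔬.blk = blkBK i bI) (hblkZ : 𝔬.blkZ = blkHK i)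
    (hG0 : 𝔬.G0 U₁ = GcoK i b B cfg O U₁) (hQs : 𝔬.Qstar U₁ = QscoKH i b B cfg parB U₁)
    {C δ c : ℝ} (hC : 0 ≤ C) (hδ : 0 ≤ δ) (hc0 : 0 ≤ c)
    (hT : HasMajorant (g := geomT i.D) (blkV1 i.hN i.D) (Gop i)
      (fun y y' => C * |i.cf|⁻¹ ^ 2 * ((ℓ : ℝ) + 1) ^ (2 * y.1.1) * Real.exp (-(δ * (geomT i.D).dist y y'))))
    (h261 : Ineq261With c (geomT i.D) δ (1 / 4)) {ε : ℝ} (hε : 0 < ε)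
    (hM : Real.log (geo9K i).L ≤ ε * (2 * ((ℓ : ℝ) + 1) ^ 2 - 1) * (geo9K i).M) {R₀ : ℝ} {H₀ : Prop} :
    HasMaj (weightNorm (BlockNorm.ofBlocks (toB6 (geo9K i) R₀ H₀) 𝔬.blkZ) (geo9K i).len fun y => (hG.lenpos y).le)
      (cNorm R₀ H₀ 𝔬.blk hG.lenle 1) (𝔬.G0 U₁ ∘ₗ 𝔬.Qstar U₁)
      (fun a a' => C * c * Real.exp (3 / 4 * δ * ((ℓ : ℝ) + 4)) * (geo9K i).L * Real.exp (-((3 / 4 * δ - ε) * (geo9K i).dist a a'))) := by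
  rw [hblk, hblkZ, hG0, hQs, GcoK_comp_QscoKH_one i b B cfg O parB hc hU₁]
  have hK := hasMajorantHom_coordOpKH_of_liftY b (G := toB6 (geo9K i) R₀ H₀) (blk' := fun a : IBondY i => a) (blk := bI)
    (T := fun _ : Fin (d + 1) => Gop i ∘ₗ Matrix.toLin' (qsK i)) (fun _ ω E => O_QsY_one_liftY i O parB hparB hO ω E)
    fun _ => hasMajorantHom_comp_qsK_bI i hlev hβ1 hC hδ 2 hT h261 R₀ H₀
  have hK0 : ∀ a a' : (geo9K i).Site, 0 ≤ C * c * Real.exp (3 / 4 * δ * ((ℓ : ℝ) + 4)) * (geo9K i).len a ^ 2 *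
      Real.exp (-(3 / 4 * δ * (geo9K i).dist a a')) := fun a a' => by
    have := (hG.lenpos a).le; positivity
  have h0 := B9Thm37AllNorms.hasMaj_of_hasMajorantHom (G := toB6 (geo9K i) R₀ H₀) (blkHK i) (blkBK i bI) hK0 hK
  refine B9SectDSup.HasMaj.weight (fun y => (hG.lenpos y).le) (wt_nonneg hG.lenle 1) h0 fun y y' => ?_
  -- `(Lʲη)(y)⁻¹ · K·(Lʲη)(y)²·e^{−¾δd} ≤ K·L·e^{−(¾δ−ε)d} · (L^{j′}η)(y′)`: one power of `Lʲη` transferred to the source block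
  have ht : (geo9K i).len y ^ 1 ≤ (geo9K i).L ^ 1 * Real.exp (ε * (geo9K i).dist y' y) * (geo9K i).len y' ^ 1 :=
    len_pow_le_of_transfer i hε 1 (by rwa [Nat.cast_one, one_mul]) y' y
  rw [pow_one, pow_one, pow_one, geo9K_dist_comm i y' y] at ht
  have hly : 0 < (geo9K i).len y := hG.lenpos y
  have hexp : Real.exp (-(3 / 4 * δ * (geo9K i).dist y y')) * Real.exp (ε * (geo9K i).dist y y') =
      Real.exp (-((3 / 4 * δ - ε) * (geo9K i).dist y y')) := by
    rw [← Real.exp_add]; congr 1; ring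
  have hKc : 0 ≤ C * c * Real.exp (3 / 4 * δ * ((ℓ : ℝ) + 4)) * Real.exp (-(3 / 4 * δ * (geo9K i).dist y y')) := by positivity
  calc wt (geo9K i) 1 y * (C * c * Real.exp (3 / 4 * δ * ((ℓ : ℝ) + 4)) * (geo9K i).len y ^ 2 *
        Real.exp (-(3 / 4 * δ * (geo9K i).dist y y')))
      = C * c * Real.exp (3 / 4 * δ * ((ℓ : ℝ) + 4)) * Real.exp (-(3 / 4 * δ * (geo9K i).dist y y')) *
          ((geo9K i).len y * ((geo9K i).len y * ((geo9K i).len y ^ 1)⁻¹)) := by rw [wt]; ring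
    _ = C * c * Real.exp (3 / 4 * δ * ((ℓ : ℝ) + 4)) * Real.exp (-(3 / 4 * δ * (geo9K i).dist y y')) * (geo9K i).len y := by
        rw [pow_one, mul_inv_cancel₀ hly.ne', mul_one]
    _ ≤ C * c * Real.exp (3 / 4 * δ * ((ℓ : ℝ) + 4)) * Real.exp (-(3 / 4 * δ * (geo9K i).dist y y')) *
          ((geo9K i).L * Real.exp (ε * (geo9K i).dist y y') * (geo9K i).len y') := mul_le_mul_of_nonneg_left ht hKc
    _ = C * c * Real.exp (3 / 4 * δ * ((ℓ : ℝ) + 4)) * (geo9K i).L *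
          (Real.exp (-(3 / 4 * δ * (geo9K i).dist y y')) * Real.exp (ε * (geo9K i).dist y y')) * (geo9K i).len y' := by ring
    _ = _ := by rw [hexp]

end Split

/-! ## §4 UNIFORMLY ON THE CENSUS: one threshold, one rate, one constant (up to the reading factor `(cR39 b)⁻¹` of `Q`) -/

section Record

variable {𝔸 : Type} [NormedRing 𝔸] [NormedAlgebra ℂ 𝔸] [CompleteSpace 𝔸] [FiniteDimensional ℝ 𝔸]
variable {κ : Type} [Fintype κ]

/-- ★★★ **THE LETTERS `q2`, `q1`, `gQs1` OF `Letters313` AT `U = 1`, UNIFORMLY ON THE k-LEVEL CENSUS** — three more `U = 1` inhabitants of the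
fields of the N06 certificate's displayed `hletters13` body: for the band `0 < b₀ ≤ b₁` there are `M₁, B₃, δ₃ > 0` such that for every index `i`
with `M ≥ M₁`, every basis `b` with `cR39 b ≠ 0`, every letter record `𝔬` over `geo9K i` with carriers `XBK ∕ Y ∕ XHK ∕ W` pinned at a
configuration `U₁` reading `1` to `GcoK … O ∕ QscoKH … parB ∕ QcoKH … parB` (`O(1)(J ⊗ E) = (GJ) ⊗ E`, transporters trivial at `1`), block maps
`blkBK bI ∕ · ∕ blkHK` with `bI` level- and 1-faithful:
`Q(U₁) : 𝔠⁽²⁾ → 𝔠_Z⁽²⁾` and `𝔠⁽¹⁾ → 𝔠_Z⁽¹⁾` with the majorant `B₃(cR39 b)⁻¹·e^{−δ₃d}`, and `G₀(U₁)Q*(U₁) : 𝔠_Z^{len} → 𝔠⁽¹⁾` with `B₃·e^{−δ₃d}`.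
[cite: Balaban1985BackgroundPropagators, Thm 3.13 p.426, (3.126) p.420, (3.42) p.397, p.398 (remark after (3.47)), Cor. 3.5 p.407; Balaban1984PropagatorsII, (2.18)–(2.20) p.226, Prop. 2.6 (2.136) p.247, Lemma 2.1 (2.60)–(2.61) p.234] -/
theorem letters313_Q_one_kIdx (hb₀ : 0 < b₀) (hb₁ : b₀ ≤ b₁) : ∃ M₁ B₃ δ₃ : ℝ, 0 < M₁ ∧ 0 < B₃ ∧ 0 < δ₃ ∧
    ∀ i : KIdx d ℓ hd hL b₀ b₁, M₁ ≤ (geo9K i).M → ∀ (hG : GeoOK (geo9K i)) [Fintype (geo9K i).Site] {Y W : Type} [Fintype Y] [Fintype W]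
      (b : Module.Basis κ ℝ 𝔸), cR39 b ≠ 0 → ∀ (B : B9.Backgrounds) (cfg : B.Cfg → CfgY 𝔸 i) (O : BondOpY 𝔸 i) (parB : BondParY 𝔸 i),
      (∀ s s', parB (fun _ _ => 1) s s' = 1) → (∀ (J : FBondY i → ℝ) (E : 𝔸), O (fun _ _ => 1) (liftY J E) = liftY (Gop i J) E) →
      ∀ {U₁ : B.Cfg}, cfg U₁ = (fun _ _ => 1) → ∀ {bI : FBondY i → IBondY i},
      (∀ f : FBondY i, lvl i.hN i.D i.hk (bI f) = (blkV1 i.hN i.D f).1.1) →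
      (∀ f : FBondY i, (geomT i.D).dist (β i.hN i.D i.hk (bI f)) (blkV1 i.hN i.D f) ≤ 1) →
      ∀ (𝔬 : Ops (geo9K i) B (XBK κ i) Y (XHK κ i) W),
      𝔬.blk = blkBK i bI → 𝔬.blkZ = blkHK i →
      𝔬.G0 U₁ = GcoK i b B cfg O U₁ → 𝔬.Qstar U₁ = QscoKH i b B cfg parB U₁ → 𝔬.Q U₁ = QcoKH i b B cfg parB U₁ →
      ∀ {R₀ : ℝ} {H₀ : Prop},
        HasMaj (cNorm R₀ H₀ 𝔬.blk hG.lenle 2) (cNorm R₀ H₀ 𝔬.blkZ hG.lenle 2) (𝔬.Q U₁)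
          (fun a a' => B₃ * (cR39 b)⁻¹ * Real.exp (-(δ₃ * (geo9K i).dist a a'))) ∧
        HasMaj (cNorm R₀ H₀ 𝔬.blk hG.lenle 1) (cNorm R₀ H₀ 𝔬.blkZ hG.lenle 1) (𝔬.Q U₁)
          (fun a a' => B₃ * (cR39 b)⁻¹ * Real.exp (-(δ₃ * (geo9K i).dist a a'))) ∧
        HasMaj (weightNorm (BlockNorm.ofBlocks (toB6 (geo9K i) R₀ H₀) 𝔬.blkZ) (geo9K i).len fun y => (hG.lenpos y).le)
          (cNorm R₀ H₀ 𝔬.blk hG.lenle 1) (𝔬.G0 U₁ ∘ₗ 𝔬.Qstar U₁) (fun a a' => B₃ * Real.exp (-(δ₃ * (geo9K i).dist a a'))) := by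
  obtain ⟨M₁, δ₃, C, hM₁, hδ₃, hC, H⟩ := hasMajorant_Gop_kIdx (d := d) (ℓ := ℓ) (hd := hd) (hL := hL) hb₀ hb₁
  obtain ⟨N, c, -, hc0, hcon⟩ := consts_260_261 d ℓ hδ₃
  -- rates: `ε := δ₃ ∕ 4` in the transfer of `gQs1` (`¾δ₃ − ¼δ₃ = ½δ₃`), `ε := ½δ₃` for the Q-letters; both (2.60) thresholds are `4 log L ∕ δ₃`
  set Lr : ℝ := (((ℓ + 1 : ℕ) : ℝ)) with hLr
  have hLr1 : 1 ≤ Lr := by rw [hLr]; exact_mod_cast Nat.succ_le_succ (Nat.zero_le ℓ)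
  set lg : ℝ := Real.log Lr with hlg
  have hlg0 : 0 ≤ lg := Real.log_nonneg hLr1
  set B₃ : ℝ := max (Lr ^ 2 * Real.exp (δ₃ * ((ℓ : ℝ) + 4))) (C * (c + 1) * Real.exp (3 / 4 * δ₃ * ((ℓ : ℝ) + 4)) * Lr) with hB₃
  have hB₃pos : 0 < B₃ := lt_max_of_lt_left (by positivity)
  refine ⟨max (max M₁ ((N : ℝ) + 1)) (4 * lg / δ₃), B₃, δ₃ / 2, lt_max_of_lt_left (lt_max_of_lt_left hM₁), hB₃pos, by positivity, ?_⟩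
  intro i hM hG _ Y W _ _ b hc B cfg O parB hparB hO U₁ hU₁ bI hlev hβ1 𝔬 hblk hblkZ hG0 hQs hQ R₀ H₀
  have hLcast : (((ℓ + 1 : ℕ) : ℝ)) = (ℓ : ℝ) + 1 := by push_cast; ring
  have hMdef : (geo9K i).M = (((ℓ + 1 : ℕ) : ℝ)) * (i.Mh : ℝ) := rfl
  have hLdef : (geo9K i).L = Lr := rfl
  have hM₁ : M₁ ≤ (kGeoG i).M := ((le_max_left _ _).trans (le_max_left _ _)).trans hM
  have hN : (N : ℝ) + 1 ≤ ((ℓ : ℝ) + 1) * i.Mh := by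
    rw [← hLcast, ← hMdef]; exact ((le_max_right _ _).trans (le_max_left _ _)).trans hM
  have hMw : 4 * lg ≤ (geo9K i).M * δ₃ := (div_le_iff₀ hδ₃).mp ((le_max_right _ _).trans hM)
  have hR1 : 1 ≤ i.R := le_trans (by omega) (toKT i).hR
  have hRN : N + 1 ≤ i.R * ((ℓ + 1) * i.Mh) := by
    have h2 : N + 1 ≤ (ℓ + 1) * i.Mh := by exact_mod_cast hN
    calc N + 1 ≤ 1 * ((ℓ + 1) * i.Mh) := by rw [one_mul]; exact h2
      _ ≤ i.R * ((ℓ + 1) * i.Mh) := Nat.mul_le_mul_right _ hR1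
  obtain ⟨-, h261⟩ := hcon i.k i.Mh i.R i.P' (one_le_Mh i) (toKT i).hP hRN
  have h261D : Ineq261With c (geomT i.D) δ₃ (1 / 4) := h261 i.D
  obtain ⟨h0, -, -, -⟩ := H i hM₁
  -- thresholds of the (2.60) transfer
  have hε2 : 0 < δ₃ / 2 := by positivity
  have hε4 : 0 < δ₃ / 4 := by positivity
  have hMq2 : ((2 : ℕ) : ℝ) * lg / (δ₃ / 2) ≤ (geo9K i).M := by rw [div_le_iff₀ hε2]; push_cast; linarith
  have hMq1 : ((1 : ℕ) : ℝ) * lg / (δ₃ / 2) ≤ (geo9K i).M := by rw [div_le_iff₀ hε2]; push_cast; linarith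
  have hMg1 : ((1 : ℕ) : ℝ) * lg / (δ₃ / 4) ≤ (geo9K i).M := by rw [div_le_iff₀ hε4]; push_cast; linarith
  have hT2 := transfer_threshold i hε2 2 hMq2
  have hT1 := transfer_threshold i hε2 1 hMq1
  have hT1' := transfer_threshold i hε4 1 hMg1
  -- the three bodies
  have hQ2 := hasMaj_Q_one (Y := Y) (W := W) (R₀ := R₀) (H₀ := H₀) i b B cfg parB hG hparB hU₁ hβ1 𝔬 hblk hblkZ hQ hε2 2 hT2
  have hQ1 := hasMaj_Q_one (Y := Y) (W := W) (R₀ := R₀) (H₀ := H₀) i b B cfg parB hG hparB hU₁ hβ1 𝔬 hblk hblkZ hQ hε2 1 hT1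
  have hS := hasMaj_G0_Qstar_one_split (Y := Y) (W := W) (R₀ := R₀) (H₀ := H₀) i b B cfg O parB hG hc hparB hO hU₁ hlev hβ1 𝔬 hblk hblkZ
    hG0 hQs hC.le hδ₃.le hc0 h0 h261D hε4 (by simpa using hT1')
  have hcinv : 0 ≤ (cR39 b)⁻¹ := inv_nonneg.mpr (cR39_nonneg b)
  refine ⟨hQ2.mono fun a a' => ?_, hQ1.mono fun a a' => ?_, hS.mono fun a a' => ?_⟩
  · have h2e : Real.exp (2 * (δ₃ / 2) * ((ℓ : ℝ) + 4)) = Real.exp (δ₃ * ((ℓ : ℝ) + 4)) := by congr 1; ring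
    rw [h2e, hLdef]
    calc (cR39 b)⁻¹ * Lr ^ 2 * Real.exp (δ₃ * ((ℓ : ℝ) + 4)) * Real.exp (-(δ₃ / 2 * (geo9K i).dist a a'))
        = Lr ^ 2 * Real.exp (δ₃ * ((ℓ : ℝ) + 4)) * (cR39 b)⁻¹ * Real.exp (-(δ₃ / 2 * (geo9K i).dist a a')) := by ring
      _ ≤ B₃ * (cR39 b)⁻¹ * Real.exp (-(δ₃ / 2 * (geo9K i).dist a a')) := by gcongr; exact le_max_left _ _
  · have h2e : Real.exp (2 * (δ₃ / 2) * ((ℓ : ℝ) + 4)) = Real.exp (δ₃ * ((ℓ : ℝ) + 4)) := by congr 1; ring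
    rw [h2e, hLdef, pow_one]
    have hL2 : Lr ≤ Lr ^ 2 := by nlinarith
    calc (cR39 b)⁻¹ * Lr * Real.exp (δ₃ * ((ℓ : ℝ) + 4)) * Real.exp (-(δ₃ / 2 * (geo9K i).dist a a'))
        = Lr * Real.exp (δ₃ * ((ℓ : ℝ) + 4)) * (cR39 b)⁻¹ * Real.exp (-(δ₃ / 2 * (geo9K i).dist a a')) := by ring
      _ ≤ Lr ^ 2 * Real.exp (δ₃ * ((ℓ : ℝ) + 4)) * (cR39 b)⁻¹ * Real.exp (-(δ₃ / 2 * (geo9K i).dist a a')) := by gcongr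
      _ ≤ B₃ * (cR39 b)⁻¹ * Real.exp (-(δ₃ / 2 * (geo9K i).dist a a')) := by gcongr; exact le_max_left _ _
  · have hre : Real.exp (-((3 / 4 * δ₃ - δ₃ / 4) * (geo9K i).dist a a')) = Real.exp (-(δ₃ / 2 * (geo9K i).dist a a')) := by
      congr 1; ring
    rw [hre, hLdef]
    calc C * c * Real.exp (3 / 4 * δ₃ * ((ℓ : ℝ) + 4)) * Lr * Real.exp (-(δ₃ / 2 * (geo9K i).dist a a'))
        ≤ C * (c + 1) * Real.exp (3 / 4 * δ₃ * ((ℓ : ℝ) + 4)) * Lr * Real.exp (-(δ₃ / 2 * (geo9K i).dist a a')) := by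
          gcongr; linarith
      _ ≤ B₃ * Real.exp (-(δ₃ / 2 * (geo9K i).dist a a')) := by gcongr; exact le_max_right _ _

end Record

end Literature.MathematicalPhysics.QuantumFieldTheory.Balaban1983to89.B9Letters313AtOneQ

end
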